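import Summits.Ventures.AbcShadow.SH02.Witness

/-!
# Venture AbcShadow — SH-02 kernel run at `ℓ = 41189` (k even, `c = -284`), part C

HONEST FRAMING. Kernel-certificate file of the work-bound cell `abc-shadow` (typer seat `abc-shadow-typ-2`); no
Diophantine statement, no claim on abc or on any summit, no side on IUT. Each `kill41189_chunk*` theorem is a
`decide +kernel` evaluation of `checkRange` (`SH02/Witness.lean`): for every `w` in the stated range, the
Frey–Hellegouarch curve `G_{w,0} : Y² = X³ + 2wX² + (w² − 73^1)X` over `𝔽_41189` carries a point `P` (found by
the checker: least `x ≥ 1` with `f(x)` a nonzero square, `y` by Tonelli–Shanks, re-verified) with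
`41474 · P ≠ O` under Mathlib's group law, hence `#G_{w,0}(𝔽_41189) ≠ 41474 = 41189 + 1 − (-284)`, i.e.
`a_41189(G_{w,0}) ≠ -284` — the cell's COMPUTED record (inv-6 K4-73bis, crit-1 j319553, third path
97fd313139c017bc) re-derived INSIDE the Lean kernel. Only `w ≤ 20594 = ⌊ℓ/2⌋` is run (`G_{−w} ≅ G_w`,
`natCard_bs23Frey_neg`, `√−1 = 13634` in `𝔽_41189`).
-/

namespace Summit.Ventures.AbcShadow

/-- Kernel run: the annihilation-witness check passes for `6000 ≤ w < 7000` at `ℓ = 41189` (`v = 0`,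
`N = 41474`). [folklore] -/
theorem kill41189_chunk6 : checkRange 41189 0 41474 10297 2 73 30 6000 1000 = true := by
  decide +kernel

/-- Kernel run: the annihilation-witness check passes for `7000 ≤ w < 8000` at `ℓ = 41189` (`v = 0`,
`N = 41474`). [folklore] -/
theorem kill41189_chunk7 : checkRange 41189 0 41474 10297 2 73 30 7000 1000 = true := by
  decide +kernel

/-- Kernel run: the annihilation-witness check passes for `8000 ≤ w < 9000` at `ℓ = 41189` (`v = 0`,
`N = 41474`). [folklore] -/
theorem kill41189_chunk8 : checkRange 41189 0 41474 10297 2 73 30 8000 1000 = true := by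
  decide +kernel

end Summit.Ventures.AbcShadow
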